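import Summits.QuantumFields.YangMills.Theorems.BalabanUVNodesN08HaarCompatibilityGuardCoreLawSU2Wide
import Summits.QuantumFields.YangMills.Theorems.UV3FibreLocalInjectivity
import Summits.QuantumFields.YangMills.Theorems.UV3WindowNetSU2
import HarnessLib

/-!
# BalabanUVNodes ∕ N08 — (H_K-core), (H_K) AND PART 20's ONE-STEP BOUND AT `N = 2` FOR EVERY BLOCK SIZE `L`, WITH AN EXPLICIT CONSTANT
# `K(L) = κ₀⁻³·q₃⁻²·N(L) + 1`, `κ₀ = L^{1−d}·sin 1·q₃`, `N(L) = (2400π·L^{d−1}∕sin 1 + 3)⁴` (item 3 lineage, the ∀-L edition of parts 29C ∕ 31)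

DAG node N08 seat `pub-ymgap-dag-n08-d` (R529-ym JOB lineage), 2026-08-30; key `--supports stmt-QuantumFields-27364 --as helper` «cc 19936 (O‴χₛ) supply».  COUNT-NEUTRAL.
DAG node N08 = [Balaban1985UV3] Thm 1 p. 257 (compact) + Thm 2 p. 272; the typed (0.4) averaging and its guard = [Balaban1987RG1] (0.4) p. 253.

THE POINT.  Parts 29C (`…GuardCoreLawSU2Wide`, `Σcᵢ ≤ 24∕25`) and 31 (`…GuardCoreLawSU2Record`, `Σcᵢ ≤ 1 − 1∕400`, i.e. `L^{d−1} ≤ 400`) discharge (H_K) at `N = 2`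
with an explicit constant on a RANGE of block sizes, the range being the injectivity input alone (one chart window + a global injectivity theorem on the guard
set).  This file removes the range: the ONE-window frame is replaced by n08-w3 part 21's MANY-window frame ✓`…GuardChartTransfer.haar_map_le_of_windows`, fed with
 • the COUNTED window cover with centres in the guard set, ym3-torus brick B4 ✓`UV3WindowNetSU2.exists_window_cover_subset_inter` (`#t ≤ (4π∕r + 3)⁴`);
 • per window, the chart conjugate `ψc` of part 29B∕29C centred at the window's own centre `w₀ ∈ S` and at `Φ_V(w₀)` (✓`exists_hasFDerivAt_chart_of_target`:
   differentiability and the tangent floor `κ₀ = (1 − Σcᵢ)·sin 1·q₃ ≥ λ′·sin 1·q₃` for EVERY `Σcᵢ ≤ 1`; ✓`chart_conj_of_target`: conjugacy and range; part 22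
   ✓`haarJacobianFloor_of_det_floor`: the Haar-Jacobian floor `m = κ₀³q₃²`);
 • per window, INJECTIVITY of `ψc` on `ball 0 r`, `r = λ′·sin 1∕600`, from brick B3b ✓`UV3FibreLocalInjectivity.injOn_chartConj_numeral` (floor + Lipschitz derivative,
   bricks B1∕B2∕B3a) — a radius LINEAR in `λ′ = 1 − Σcᵢ = L^{1−d}`, valid for every `Σcᵢ < 1`.
 §1 ★★★ `core_law_le_su2_of_pos`: (H_K-core) at `N = 2` for EVERY coarse bond and frozen family, any `0 < λ′ ≤ 1 − #nc∕|Idx|`: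
    `Haar∘Φ_V⁻¹ ≤ (m⁻¹·N + 1)•Haar`, `m = (λ′ sin 1 q₃)³q₃²`, `N = (2400π∕(λ′ sin 1) + 3)⁴`, `q₃ = sin(π∕3)∕(π∕3)` — no range hypothesis, no base point.
 §2 `card_not_central_div_eq` (`#nc∕|Idx| = 1 − L^{1−d}`, part 11's count) · ★★★ `core_law_le_su2_allL` (§1 at `λ′ = L^{1−d}`) · `kallL_pos` ·
    ★★ `fibre_law_le_su2_allL` ((H_K) at `N = 2`, EVERY `L`, constant `K(L)` displayed) · ★★ `smul_map_avOfPrint_le_su2_allL` (part 20's one-step bound at the slot).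

HONEST FRAMING.  Bookkeeping over parts 20–29C, n08-w6's dictionary and the ym3-torus bricks B1–B4 BY IMPORT; ONE RG step; the k-uniform `hmass` NOT supplied
(stacking); E6′ NOT decided; the constant is NOT optimised (`K(L) ≈ 2.8·10¹⁶·L^{7(d−1)}`); count-neutral; N08 NOT discharged; nothing of (O‴χₛ) ∕ `HistoryTailL`
(19936) ∕ hTop is proved here; no summit statement is proved by this seat — R4 closes the CONDITIONAL finite-𝕋⁴ rung `BalabanLadder.UV` only, R3 = SU(2) YM₃ on T³ is
NOT d = 4, NOT infinite volume, NOT a mass gap; the Yang–Mills mass gap (Clay) is NOT proved by any of this; nothing continuum ∕ OS.  0 `sorry`, 0 `def`,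
0 `instance`, 0 `notation`, standard axioms.
-/

set_option autoImplicit false

noncomputable section

open NormedSpace Set Metric Function Filter MeasureTheory
open scoped RealInnerProductSpace Topology Quaternion ENNReal

namespace Summit.QuantumFields.YangMills.BalabanUVNodes.N08HaarCompatibilityGuardCoreLawSU2AllL

open Literature.MathematicalPhysics.QuantumFieldTheory (haarProbability)
open Literature.MathematicalPhysics.QuantumFieldTheory.Balaban1983to89
open Literature.MathematicalPhysics.QuantumFieldTheory.Balaban1983to89.T4QuatExpLog
open Literature.MathematicalPhysics.QuantumFieldTheory.Balaban1983to89.T4EMLFibreAC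
open Literature.MathematicalPhysics.QuantumFieldTheory.Balaban1983to89.T4HaarSU2ExpChart (imQuat imQuat_re norm_imQuat expPoint
  su2Quat_expPoint injOn_expPoint)
open Literature.MathematicalPhysics.QuantumFieldTheory.Balaban1983to89.T4ExpWindowSmallField (imVec dist1_eq_norm_su2Quat_sub_one)
open Literature.MathematicalPhysics.QuantumFieldTheory.Balaban1983to89.B10Eq18SigmaSU2Haar (rev rev_rev norm_rev expPauli expPauli_eq_expPoint
  measurable_expPauli)
open Literature.MathematicalPhysics.QuantumFieldTheory.Balaban1983to89.B10Eq22Rescaling (sigmaSU2)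
open Literature.MathematicalPhysics.QuantumFieldTheory.Balaban1983to89.ExpMeanLog (expMeanLogSU expMeanLogSU_δ deltaSU lt_third_of_lt_deltaSU
  measurable_expMeanLogSU_E)
open Literature.MathematicalPhysics.QuantumFieldTheory.Balaban1983to89.BlockAveraging (Idx)
open Literature.MathematicalPhysics.QuantumFieldTheory.Balaban1983to89.BlockAveraging (Small avgFun)
open Literature.MathematicalPhysics.QuantumFieldTheory.Balaban1983to89.BlockAveragingHaarAC (IsCentral centralBond nCentral)
open Summit.QuantumFields.YangMills.BalabanUVNodes.N08HaarCompatibilityGuardPowerMap (nCentral_mul_pow nCentral_div_card_real nCentral_le_card)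
open Literature.MathematicalPhysics.QuantumFieldTheory.Balaban1985CMP102.Setting (Scales)
open Literature.MathematicalPhysics.QuantumFieldTheory.Balaban1983to89.B10RunsOfRecord (avOfPrint)
open Summit.QuantumFields.YangMills.BalabanUVNodes.N08HaarCompatibilityGuardFibreCore (fibre_law_le_of_core smul_map_avOfPrint_le_of_core measurable_core)
open Literature.MathematicalPhysics.QuantumLattice (quatMatrix su2Quat norm_su2Quat quatToSU2 quatToSU2_su2Quat quatMatrix_su2Quat)
open Literature.MathematicalPhysics.QuantumFieldTheory.Balaban1983to89.T4HaarSU2Translate (su2Quat_mul haarData_haar_eq)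
open Summit.QuantumFields.YangMills.BalabanUVNodes.N08HaarCompatibilityGuardGeodesics
open Summit.QuantumFields.YangMills.BalabanUVNodes.N08HaarCompatibilityGuardCoreInjective
open Summit.QuantumFields.YangMills.BalabanUVNodes.N08HaarCompatibilityGuardChartLift
open Summit.QuantumFields.YangMills.BalabanUVNodes.N08HaarCompatibilityGuardCoreChart
open Summit.QuantumFields.YangMills.BalabanUVNodes.N08HaarCompatibilityGuardCoreChartTarget
open Summit.QuantumFields.YangMills.BalabanUVNodes.N08HaarCompatibilityGuardCoreLawSU2 (delta_two kf_eq_su2Quat_core quat_guard)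
open Summit.QuantumFields.YangMills.BalabanUVNodes.N08HaarCompatibilityGuardChartTransfer (haar_map_le_of_windows)
open Summit.QuantumFields.YangMills.BalabanUVNodes.N08HaarCompatibilityGuardCoerciveWindows (haarJacobianFloor_of_det_floor)
open Summit.QuantumFields.YangMills.Theorems.UV3FibreLocalInjectivity (injOn_chartConj_numeral)
open Summit.QuantumFields.YangMills.Theorems.UV3WindowNetSU2 (exists_window_cover_subset_inter)

variable {P : Params} {j : ℕ}

/-! ## §1 (H_K-core) at `N = 2` for every `Σcᵢ < 1`: many windows of radius `λ′·sin 1∕600` -/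

/-- ★★★ **(H_K-core) AT `N = 2`, NO RANGE.**  For the printed average on `SU(2)`, every coarse bond `c`, every frozen family `V : Idx → SU(2)`, and every
`0 < λ′ ≤ 1 − s`, `s := #non-central∕|Idx|`:
**`Haar ∘ Φ_V⁻¹ ≤ (m⁻¹·N + 1)•Haar`,  `m = (λ′·sin 1·q₃)³·q₃²`,  `N = (2400π∕(λ′·sin 1) + 3)⁴`,  `q₃ = sin(π∕3)∕(π∕3)`** — part 21's many-window frame
✓`haar_map_le_of_windows` (`τ = id`) over the counted cover ✓`exists_window_cover_subset_inter` of the guard set by chart windows of radius `r = λ′·sin 1∕600` centred IN the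
guard set; on each window the chart conjugate of part 29B centred at `(w₀, Φ_V w₀)` with derivative floor `κ₀ ≥ λ′ sin 1 q₃` (✓`exists_hasFDerivAt_chart_of_target`, every
`Σcᵢ ≤ 1`) ⇒ determinant floor (✓`pow_le_abs_det_of_norm_le`) ⇒ Haar-Jacobian floor (✓`haarJacobianFloor_of_det_floor`); injectivity per window from
✓`injOn_chartConj_numeral` (`600·r ≤ (1 − Σcᵢ)·sin 1`).  No base point and no non-central index are needed (an empty guard set has the empty cover).
Count-neutral; the constant is NOT optimised. [cite: Balaban1987RG1, (0.4) p.253; Balaban1985UV3, p.260 (bookkeeping — the bound is NOT in print)] -/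
theorem core_law_le_su2_of_pos (c : PBond P (j + 1)) (V : Idx P → (Matrix.specialUnitaryGroup (Fin 2) ℂ)) {lam : ℝ} (hlam : 0 < lam)
    (hlams : lam ≤ 1 - (Fintype.card {i : Idx P // ¬ IsCentral c i} : ℝ) * ((Fintype.card (Idx P) : ℝ))⁻¹) :
    (haarProbability (Matrix.specialUnitaryGroup (Fin 2) ℂ)).map (fun w : (Matrix.specialUnitaryGroup (Fin 2) ℂ) =>
      (if ∀ i : Idx P, dist1 (if IsCentral c i then (1 : (Matrix.specialUnitaryGroup (Fin 2) ℂ)) else V i * w⁻¹) < (expMeanLogSU : LoopAverage (Matrix.specialUnitaryGroup (Fin 2) ℂ)).δ then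
          (expMeanLogSU : LoopAverage (Matrix.specialUnitaryGroup (Fin 2) ℂ)).avg (fun i : Idx P => if IsCentral c i then (1 : (Matrix.specialUnitaryGroup (Fin 2) ℂ)) else V i * w⁻¹) else 1) * w) ≤
      ((ENNReal.ofReal ((lam * Real.sin 1 * (Real.sin (Real.pi / 3) / (Real.pi / 3))) ^ 3 * (Real.sin (Real.pi / 3) / (Real.pi / 3)) ^ 2))⁻¹ *
          ENNReal.ofReal ((2400 * Real.pi / (lam * Real.sin 1) + 3) ^ 4) + 1) •
        haarProbability (Matrix.specialUnitaryGroup (Fin 2) ℂ) := by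
  classical
  set s : ℝ := (Fintype.card {i : Idx P // ¬ IsCentral c i} : ℝ) * ((Fintype.card (Idx P) : ℝ))⁻¹ with hs_def
  set q3 : ℝ := Real.sin (Real.pi / 3) / (Real.pi / 3) with hq3_def
  set κ₀ : ℝ := lam * Real.sin 1 * q3 with hκ₀_def
  have hπ3 : Real.pi / 3 ≤ Real.pi := by linarith [Real.pi_gt_three]
  have hq3pos : 0 < q3 := div_pos (Real.sin_pos_of_pos_of_lt_pi (by positivity) (by linarith [Real.pi_gt_three])) (by positivity)
  have hsin1 : 0 < Real.sin 1 := Real.sin_pos_of_pos_of_lt_pi one_pos (by linarith [Real.pi_gt_three])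
  have hsin1' : Real.sin 1 ≤ 1 := Real.sin_le_one 1
  have hs0 : 0 ≤ s := by rw [hs_def]; positivity
  have hlam1 : lam ≤ 1 := by linarith
  have hκ₀ : 0 < κ₀ := by positivity
  set m : ℝ≥0∞ := ENNReal.ofReal (κ₀ ^ 3 * q3 ^ 2) with hm_def
  have hm0 : m ≠ 0 := (ENNReal.ofReal_pos.2 (by positivity)).ne'
  have hmt : m ≠ ∞ := ENNReal.ofReal_ne_top
  -- letters of the quaternion model
  set a : {i : Idx P // ¬ IsCentral c i} → ℍ := fun i => su2Quat (V i) with ha_def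
  set cw : {i : Idx P // ¬ IsCentral c i} → ℝ := fun _ => ((Fintype.card (Idx P) : ℝ))⁻¹ with hcw_def
  have ha : ∀ i, ‖a i‖ = 1 := fun i => norm_su2Quat (V i)
  have hc : ∀ i, 0 ≤ cw i := fun _ => inv_nonneg.2 (Nat.cast_nonneg _)
  have hcs : ∑ i, cw i = s := by rw [hcw_def, Finset.sum_const, Finset.card_univ, nsmul_eq_mul]
  have hlams' : lam ≤ 1 - ∑ i, cw i := by rw [hcs]; exact hlams
  have hs1 : ∑ i, cw i ≤ 1 := by linarith
  have hslt : ∑ i, cw i < 1 := by linarith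
  set S : Set (Matrix.specialUnitaryGroup (Fin 2) ℂ) := {w : (Matrix.specialUnitaryGroup (Fin 2) ℂ) | ∀ i : Idx P, dist1 (if IsCentral c i then (1 : (Matrix.specialUnitaryGroup (Fin 2) ℂ)) else V i * w⁻¹) < (expMeanLogSU : LoopAverage (Matrix.specialUnitaryGroup (Fin 2) ℂ)).δ} with hS_def
  -- measurability
  have hΦ := measurable_core (expMeanLogSU : LoopAverage (Matrix.specialUnitaryGroup (Fin 2) ℂ)) measurable_expMeanLogSU_E c V
  have hSm : MeasurableSet S := by
    have hF : Measurable fun w : (Matrix.specialUnitaryGroup (Fin 2) ℂ) => fun i : Idx P => if IsCentral c i then (1 : (Matrix.specialUnitaryGroup (Fin 2) ℂ)) else V i * w⁻¹ := by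
      refine measurable_pi_lambda _ fun i => ?_
      by_cases h : IsCentral c i
      · simp only [if_pos h]; exact measurable_const
      · simp only [if_neg h]; exact (measurable_const_mul (V i)).comp measurable_inv
    have : S = ⋂ i : Idx P, {w : (Matrix.specialUnitaryGroup (Fin 2) ℂ) | dist1 (if IsCentral c i then (1 : (Matrix.specialUnitaryGroup (Fin 2) ℂ)) else V i * w⁻¹) < (expMeanLogSU : LoopAverage (Matrix.specialUnitaryGroup (Fin 2) ℂ)).δ} := by ext w; simp [hS_def]
    rw [this]
    exact MeasurableSet.iInter fun i =>
      measurableSet_lt (RegularGaugeGroup.measurable_dist1.comp ((measurable_pi_apply i).comp hF)) measurable_const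
  -- the radius and the counted cover (brick B4)
  set r : ℝ := lam * Real.sin 1 / 600 with hr_def
  have hr0 : 0 < r := by positivity
  have hr600 : 600 * r ≤ (1 - ∑ i, cw i) * Real.sin 1 := by
    rw [hr_def]
    have : 600 * (lam * Real.sin 1 / 600) = lam * Real.sin 1 := by ring
    rw [this]
    exact mul_le_mul_of_nonneg_right hlams' hsin1.le
  have hr1 : r < 1 := by
    rw [hr_def]
    have : lam * Real.sin 1 ≤ 1 := by nlinarith
    linarith
  have hrπ3 : r < Real.pi / 3 := by linarith [Real.pi_gt_three]
  obtain ⟨t, htS, htc, hcov⟩ := exists_window_cover_subset_inter S (ρ := r / Real.pi) (r := r) (by positivity) (le_of_eq (by field_simp))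
  -- the windows
  set W : (Matrix.specialUnitaryGroup (Fin 2) ℂ) → Set (EuclideanSpace ℝ (Fin 3)) :=
    fun w₀ => ball (0 : EuclideanSpace ℝ (Fin 3)) r ∩ {A | w₀ * expPauli A ∈ S} with hW_def
  have hquat : ∀ (w₀ : Matrix.specialUnitaryGroup (Fin 2) ℂ) (A : EuclideanSpace ℝ (Fin 3)), su2Quat (w₀ * expPauli A) = su2Quat w₀ * exp (imQuat (rev A)) := fun w₀ A => by
    rw [su2Quat_mul, expPauli_eq_expPoint, su2Quat_expPoint]
  have hWS : ∀ w₀, ∀ A ∈ W w₀, (w₀ * expPauli A) ∈ S := fun w₀ A hA => hA.2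
  have hWr : ∀ w₀, ∀ A ∈ W w₀, ‖A‖ < r := fun w₀ A hA => mem_ball_zero_iff.1 hA.1
  have hWπ3 : ∀ w₀, ∀ A ∈ W w₀, ‖A‖ < Real.pi / 3 := fun w₀ A hA => (hWr w₀ A hA).trans hrπ3
  have hu : ∀ w₀ : Matrix.specialUnitaryGroup (Fin 2) ℂ, ‖su2Quat w₀‖ = 1 := fun w₀ => norm_su2Quat w₀
  have hW1 : ∀ (w₀ : Matrix.specialUnitaryGroup (Fin 2) ℂ) (A : EuclideanSpace ℝ (Fin 3)), ‖su2Quat w₀ * exp (imQuat (rev A))‖ = 1 := fun w₀ A => by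
    rw [← hquat]; exact norm_su2Quat _
  have hWg : ∀ w₀, ∀ A ∈ W w₀, ∀ i, ‖a i * star (su2Quat w₀ * exp (imQuat (rev A))) - 1‖ < 1 / 3 := fun w₀ A hA i => by
    rw [← hquat]; exact quat_guard c V (hWS w₀ A hA) i
  have hWg2 : ∀ w₀, ∀ A ∈ W w₀, ∀ i, ‖a i * star (su2Quat w₀ * exp (imQuat (rev A))) - 1‖ < 1 / 2 := fun w₀ A hA i =>
    (hWg w₀ A hA i).trans (by norm_num)
  have hg0' : ∀ w₀ ∈ S, ∀ i, ‖a i * star (su2Quat w₀) - 1‖ < 1 / 3 := fun w₀ hw₀ i => quat_guard c V hw₀ i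
  have hg0 : ∀ w₀ ∈ S, ∀ i, ‖a i - su2Quat w₀‖ < 1 / 3 := fun w₀ hw₀ i => by rw [← norm_mul_star_sub_one (hu w₀)]; exact hg0' w₀ hw₀ i
  have hg1 : ∀ w₀, ∀ A ∈ W w₀, ∀ i, ‖a i - su2Quat w₀ * exp (imQuat (rev A))‖ < 1 / 3 := fun w₀ A hA i => by
    rw [← norm_mul_star_sub_one (hW1 w₀ A)]; exact hWg w₀ A hA i
  -- the target centres `w₁(w₀) := Φ_V(w₀)` and `z(w₀) := su2Quat (w₁ w₀) = k(su2Quat w₀)`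
  set w₁ : (Matrix.specialUnitaryGroup (Fin 2) ℂ) → (Matrix.specialUnitaryGroup (Fin 2) ℂ) := fun w₀ =>
    (expMeanLogSU : LoopAverage (Matrix.specialUnitaryGroup (Fin 2) ℂ)).avg
      (fun i : Idx P => if IsCentral c i then (1 : (Matrix.specialUnitaryGroup (Fin 2) ℂ)) else V i * w₀⁻¹) * w₀ with hw₁_def
  set z : (Matrix.specialUnitaryGroup (Fin 2) ℂ) → ℍ := fun w₀ => su2Quat (w₁ w₀) with hz_def
  have hz : ∀ w₀, ‖z w₀‖ = 1 := fun w₀ => norm_su2Quat (w₁ w₀)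
  have hzk : ∀ w₀ ∈ S, kf a cw (su2Quat w₀) = z w₀ := fun w₀ hw₀ => kf_eq_su2Quat_core c V hw₀
  set ψ : (Matrix.specialUnitaryGroup (Fin 2) ℂ) → EuclideanSpace ℝ (Fin 3) → EuclideanSpace ℝ (Fin 3) :=
    fun w₀ A => rev (imVec (qlog (star (z w₀) * kf a cw (su2Quat w₀ * exp (imQuat (rev A)))))) with hψ_def
  -- the log-ball condition at the centre, by part 29A's 1-Lipschitz bound (`‖A‖ < r < 1`)
  have hv : ∀ w₀ ∈ S, ∀ A ∈ W w₀, ‖star (z w₀) * kf a cw (su2Quat w₀ * exp (imQuat (rev A)))‖ = 1 ∧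
      ‖star (z w₀) * kf a cw (su2Quat w₀ * exp (imQuat (rev A))) - 1‖ < 1 := by
    intro w₀ hw₀ A hA
    obtain ⟨h1, h2⟩ := norm_target_kf_sub_one_le cw (hu w₀) ha hc hs1 (by norm_num : (1 / 3 : ℝ) ≤ 1 / 2) (hWπ3 w₀ A hA) (hg0 w₀ hw₀) (hg1 w₀ A hA)
    rw [hzk w₀ hw₀] at h1 h2
    exact ⟨h1, h2.trans_lt ((hWr w₀ A hA).trans hr1)⟩
  have key : ∀ w₀ ∈ t, ∀ A ∈ W w₀, ∃ D : EuclideanSpace ℝ (Fin 3) →L[ℝ] EuclideanSpace ℝ (Fin 3), HasFDerivAt (ψ w₀) D A ∧ ∀ h, κ₀ * ‖h‖ ≤ ‖D h‖ := by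
    intro w₀ hw₀ A hA
    obtain ⟨D, hD, hfl⟩ := exists_hasFDerivAt_chart_of_target cw (hu w₀) (hz w₀) ha hc hs1 (hWπ3 w₀ A hA) (hWg2 w₀ A hA) (hv w₀ (htS hw₀) A hA).2
    refine ⟨D, hD, fun h => (le_trans ?_ (hfl h))⟩
    have e : Real.sin (Real.pi / 3) / (Real.pi / 3) = q3 := rfl
    rw [e, hκ₀_def]
    have h0 : 0 ≤ Real.sin 1 * q3 * ‖h‖ := by positivity
    calc lam * Real.sin 1 * q3 * ‖h‖ = lam * (Real.sin 1 * q3 * ‖h‖) := by ring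
      _ ≤ (1 - ∑ i, cw i) * (Real.sin 1 * q3 * ‖h‖) := mul_le_mul_of_nonneg_right hlams' h0
      _ = (1 - ∑ i, cw i) * Real.sin 1 * q3 * ‖h‖ := by ring
  choose! D hD hfloor using key
  -- the conjugacy and the range
  have hconjq : ∀ w₀ ∈ S, ∀ A ∈ W w₀, z w₀ * exp (imQuat (rev (ψ w₀ A))) = kf a cw (su2Quat w₀ * exp (imQuat (rev A))) ∧ ‖ψ w₀ A‖ < Real.pi / 3 :=
    fun w₀ hw₀ A hA => chart_conj_of_target cw (hz w₀) (hv w₀ hw₀ A hA).1 (hv w₀ hw₀ A hA).2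
  have hsu2inj : Function.Injective (su2Quat : (Matrix.specialUnitaryGroup (Fin 2) ℂ) → ℍ) := Function.LeftInverse.injective quatToSU2_su2Quat
  have hconj : ∀ w₀ ∈ t, ∀ A ∈ W w₀,
      (if ∀ i : Idx P, dist1 (if IsCentral c i then (1 : (Matrix.specialUnitaryGroup (Fin 2) ℂ)) else V i * ((fun w : Matrix.specialUnitaryGroup (Fin 2) ℂ => w) w₀ * expPauli A)⁻¹) < (expMeanLogSU : LoopAverage (Matrix.specialUnitaryGroup (Fin 2) ℂ)).δ then
          (expMeanLogSU : LoopAverage (Matrix.specialUnitaryGroup (Fin 2) ℂ)).avg (fun i : Idx P => if IsCentral c i then (1 : (Matrix.specialUnitaryGroup (Fin 2) ℂ)) else V i * ((fun w : Matrix.specialUnitaryGroup (Fin 2) ℂ => w) w₀ * expPauli A)⁻¹) else 1) *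
        ((fun w : Matrix.specialUnitaryGroup (Fin 2) ℂ => w) w₀ * expPauli A) = w₁ w₀ * expPauli (ψ w₀ A) := by
    intro w₀ hw₀ A hA
    have hg : ∀ i : Idx P, dist1 (if IsCentral c i then (1 : (Matrix.specialUnitaryGroup (Fin 2) ℂ)) else V i * (w₀ * expPauli A)⁻¹) < (expMeanLogSU : LoopAverage (Matrix.specialUnitaryGroup (Fin 2) ℂ)).δ := hWS w₀ A hA
    show (if ∀ i : Idx P, dist1 (if IsCentral c i then (1 : (Matrix.specialUnitaryGroup (Fin 2) ℂ)) else V i * (w₀ * expPauli A)⁻¹) < (expMeanLogSU : LoopAverage (Matrix.specialUnitaryGroup (Fin 2) ℂ)).δ then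
          (expMeanLogSU : LoopAverage (Matrix.specialUnitaryGroup (Fin 2) ℂ)).avg (fun i : Idx P => if IsCentral c i then (1 : (Matrix.specialUnitaryGroup (Fin 2) ℂ)) else V i * (w₀ * expPauli A)⁻¹) else 1) *
        (w₀ * expPauli A) = w₁ w₀ * expPauli (ψ w₀ A)
    rw [if_pos hg]
    apply hsu2inj
    rw [← kf_eq_su2Quat_core c V (hWS w₀ A hA), hquat, su2Quat_mul, expPauli_eq_expPoint, su2Quat_expPoint, (hconjq w₀ (htS hw₀) A hA).1]
  have hmaps : ∀ w₀ ∈ t, MapsTo (ψ w₀) (W w₀) (ball (0 : EuclideanSpace ℝ (Fin 3)) Real.pi) := fun w₀ hw₀ A hA =>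
    mem_ball_zero_iff.2 ((hconjq w₀ (htS hw₀) A hA).2.trans_le hπ3)
  -- injectivity per window: brick B3b
  have hinj : ∀ w₀ ∈ t, InjOn (ψ w₀) (W w₀) := fun w₀ hw₀ =>
    injOn_chartConj_numeral cw ha hc hslt (hu w₀) (fun i => (hg0' w₀ (htS hw₀) i).le) hr0.le hr600 (hz w₀) (inter_subset_left) (hv w₀ (htS hw₀))
  -- the Haar-Jacobian floor through the determinant floor
  have hdet : ∀ w₀ ∈ t, ∀ A ∈ W w₀, κ₀ ^ 3 ≤ |(D w₀ A).det| := fun w₀ hw₀ A hA => by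
    have h := pow_le_abs_det_of_norm_le (D w₀ A) hκ₀ (hfloor w₀ hw₀ A hA)
    rwa [Fintype.card_fin] at h
  have hm : ∀ w₀ ∈ t, ∀ A ∈ W w₀,
      m * ENNReal.ofReal (sigmaSU2 ‖A‖) ≤ ENNReal.ofReal |(D w₀ A).det| * ENNReal.ofReal (sigmaSU2 ‖ψ w₀ A‖) := fun w₀ hw₀ =>
    haarJacobianFloor_of_det_floor (W := W w₀) (ψc := ψ w₀) (ψc' := D w₀) (r₀ := Real.pi / 3) (m₀ := κ₀ ^ 3) (by positivity) hπ3
      (by positivity) (fun A hA => (hconjq w₀ (htS hw₀) A hA).2.le) (hdet w₀ hw₀)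
  have hWm : ∀ w₀ ∈ t, MeasurableSet (W w₀) := fun w₀ _ =>
    measurableSet_ball.inter ((measurable_const_mul w₀).comp measurable_expPauli hSm)
  have hWπ : ∀ w₀ ∈ t, W w₀ ⊆ ball (0 : EuclideanSpace ℝ (Fin 3)) Real.pi := fun w₀ _ =>
    inter_subset_left.trans (ball_subset_ball (hrπ3.le.trans hπ3))
  have heq : ∀ w, w ∉ S → (if ∀ i : Idx P, dist1 (if IsCentral c i then (1 : (Matrix.specialUnitaryGroup (Fin 2) ℂ)) else V i * w⁻¹) < (expMeanLogSU : LoopAverage (Matrix.specialUnitaryGroup (Fin 2) ℂ)).δ then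
          (expMeanLogSU : LoopAverage (Matrix.specialUnitaryGroup (Fin 2) ℂ)).avg (fun i : Idx P => if IsCentral c i then (1 : (Matrix.specialUnitaryGroup (Fin 2) ℂ)) else V i * w⁻¹) else 1) * w = id w := by
    intro w hw
    have hw' : ¬ ∀ i : Idx P, dist1 (if IsCentral c i then (1 : (Matrix.specialUnitaryGroup (Fin 2) ℂ)) else V i * w⁻¹) < (expMeanLogSU : LoopAverage (Matrix.specialUnitaryGroup (Fin 2) ℂ)).δ := hw
    simp only [if_neg hw', one_mul, id]
  -- assemble with part 21
  have h := haar_map_le_of_windows hΦ measurable_id (by rw [Measure.map_id]) hSm heq t (fun w : Matrix.specialUnitaryGroup (Fin 2) ℂ => w) w₁ W hWm hWπ ψ D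
    hconj hmaps (fun w₀ hw₀ A hA => (hD w₀ hw₀ A hA).hasFDerivWithinAt) hinj hm0 hmt hm hcov
  -- the count `#t ≤ (4π∕r + 3)⁴ = (2400π∕(λ′ sin 1) + 3)⁴`
  have hN : (t.card : ℝ) ≤ (2400 * Real.pi / (lam * Real.sin 1) + 3) ^ 4 := by
    have e : 4 / (r / Real.pi) = 2400 * Real.pi / (lam * Real.sin 1) := by
      rw [hr_def]; field_simp; ring
    rw [← e]; exact htc
  have hN' : (t.card : ℝ≥0∞) ≤ ENNReal.ofReal ((2400 * Real.pi / (lam * Real.sin 1) + 3) ^ 4) := by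
    rw [← ENNReal.ofReal_natCast]; exact ENNReal.ofReal_le_ofReal hN
  refine h.trans (Measure.le_iff'.2 fun u => ?_)
  rw [Measure.smul_apply, Measure.smul_apply, smul_eq_mul, smul_eq_mul]
  gcongr

/-! ## §2 The constant in the letters of the block: `λ′ = L^{1−d}` -/

/-- By part 11's count `N_c·L^{d−1} = |Idx|`: `#non-central∕|Idx| = 1 − (L^{d−1})⁻¹` for every coarse bond `c`. [folklore] -/
theorem card_not_central_div_eq (c : PBond P (j + 1)) :
    (Fintype.card {i : Idx P // ¬ IsCentral c i} : ℝ) * ((Fintype.card (Idx P) : ℝ))⁻¹ = 1 - (((P.L : ℝ) ^ (P.d - 1)))⁻¹ := by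
  classical
  have hcard : (0 : ℝ) < Fintype.card (Idx P) := Nat.cast_pos.mpr Fintype.card_pos
  have hnc : (Fintype.card {i : Idx P // ¬ IsCentral c i} : ℝ) = Fintype.card (Idx P) - nCentral c := by
    have h1 : Fintype.card {i : Idx P // IsCentral c i} = nCentral c := by rw [nCentral, Fintype.card_subtype]
    have h2 := Fintype.card_subtype_compl (IsCentral c)
    rw [h1] at h2
    have h3 : nCentral c ≤ Fintype.card (Idx P) := nCentral_le_card c
    rw [h2, Nat.cast_sub h3]
  have hlam : (nCentral c : ℝ) / (Fintype.card (Idx P) : ℝ) = ((P.L : ℝ) ^ (P.d - 1))⁻¹ := nCentral_div_card_real c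
  rw [hnc, sub_mul, mul_inv_cancel₀ hcard.ne', ← div_eq_mul_inv, hlam]

/-- `0 < L^{1−d} ≤ 1` (`1 < L`). [folklore] -/
theorem lambda_pos_le_one : 0 < (((P.L : ℝ) ^ (P.d - 1)))⁻¹ ∧ (((P.L : ℝ) ^ (P.d - 1)))⁻¹ ≤ 1 := by
  have hL : (1 : ℝ) ≤ P.L := by exact_mod_cast P.hL.2.le
  have hLpow : (1 : ℝ) ≤ (P.L : ℝ) ^ (P.d - 1) := one_le_pow₀ hL
  exact ⟨inv_pos.2 (by positivity), inv_le_one_of_one_le₀ hLpow⟩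

/-- ★★★ **(H_K-core) AT `N = 2` FOR EVERY BLOCK SIZE `L`** — §1 at `λ′ = L^{1−d}` (equality in `λ′ ≤ 1 − s` by `card_not_central_div_eq`):
`Haar∘Φ_V⁻¹ ≤ K(L)•Haar`, **`K(L) = ((L^{1−d} sin 1 q₃)³q₃²)⁻¹·(2400π·∕(L^{1−d} sin 1) + 3)⁴ + 1`**, for every coarse bond and frozen family, no range hypothesis.
[cite: Balaban1987RG1, (0.4) p.253; Balaban1985UV3, p.260 (bookkeeping — the bound is NOT in print)] -/
theorem core_law_le_su2_allL (c : PBond P (j + 1)) (V : Idx P → (Matrix.specialUnitaryGroup (Fin 2) ℂ)) :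
    (haarProbability (Matrix.specialUnitaryGroup (Fin 2) ℂ)).map (fun w : (Matrix.specialUnitaryGroup (Fin 2) ℂ) =>
      (if ∀ i : Idx P, dist1 (if IsCentral c i then (1 : (Matrix.specialUnitaryGroup (Fin 2) ℂ)) else V i * w⁻¹) < (expMeanLogSU : LoopAverage (Matrix.specialUnitaryGroup (Fin 2) ℂ)).δ then
          (expMeanLogSU : LoopAverage (Matrix.specialUnitaryGroup (Fin 2) ℂ)).avg (fun i : Idx P => if IsCentral c i then (1 : (Matrix.specialUnitaryGroup (Fin 2) ℂ)) else V i * w⁻¹) else 1) * w) ≤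
      ((ENNReal.ofReal (((((P.L : ℝ) ^ (P.d - 1)))⁻¹ * Real.sin 1 * (Real.sin (Real.pi / 3) / (Real.pi / 3))) ^ 3 * (Real.sin (Real.pi / 3) / (Real.pi / 3)) ^ 2))⁻¹ *
          ENNReal.ofReal ((2400 * Real.pi / ((((P.L : ℝ) ^ (P.d - 1)))⁻¹ * Real.sin 1) + 3) ^ 4) + 1) •
        haarProbability (Matrix.specialUnitaryGroup (Fin 2) ℂ) :=
  core_law_le_su2_of_pos c V lambda_pos_le_one.1 (by rw [card_not_central_div_eq c]; linarith)

/-- The uniform constant's core is positive: `0 < (L^{1−d}·sin 1·q₃)³·q₃²`. [folklore] -/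
theorem mstar_allL_pos : 0 < ((((P.L : ℝ) ^ (P.d - 1)))⁻¹ * Real.sin 1 * (Real.sin (Real.pi / 3) / (Real.pi / 3))) ^ 3 * (Real.sin (Real.pi / 3) / (Real.pi / 3)) ^ 2 := by
  have hsin1 : 0 < Real.sin 1 := Real.sin_pos_of_pos_of_lt_pi one_pos (by linarith [Real.pi_gt_three])
  have hq : 0 < Real.sin (Real.pi / 3) / (Real.pi / 3) :=
    div_pos (Real.sin_pos_of_pos_of_lt_pi (by positivity) (by linarith [Real.pi_gt_three])) (by positivity)
  have hl := (lambda_pos_le_one (P := P)).1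
  positivity

/-- `1 ≤ K(L)` and `K(L) ≠ ∞` (the assembler's finiteness letters). [folklore] -/
theorem one_le_kallL_and_ne_top :
    1 ≤ ((ENNReal.ofReal (((((P.L : ℝ) ^ (P.d - 1)))⁻¹ * Real.sin 1 * (Real.sin (Real.pi / 3) / (Real.pi / 3))) ^ 3 * (Real.sin (Real.pi / 3) / (Real.pi / 3)) ^ 2))⁻¹ *
          ENNReal.ofReal ((2400 * Real.pi / ((((P.L : ℝ) ^ (P.d - 1)))⁻¹ * Real.sin 1) + 3) ^ 4) + 1) ∧
    ((ENNReal.ofReal (((((P.L : ℝ) ^ (P.d - 1)))⁻¹ * Real.sin 1 * (Real.sin (Real.pi / 3) / (Real.pi / 3))) ^ 3 * (Real.sin (Real.pi / 3) / (Real.pi / 3)) ^ 2))⁻¹ *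
          ENNReal.ofReal ((2400 * Real.pi / ((((P.L : ℝ) ^ (P.d - 1)))⁻¹ * Real.sin 1) + 3) ^ 4) + 1) ≠ ∞ :=
  ⟨le_add_self, ENNReal.add_ne_top.2 ⟨ENNReal.mul_ne_top (ENNReal.inv_ne_top.2 (ENNReal.ofReal_pos.2 mstar_allL_pos).ne') ENNReal.ofReal_ne_top,
    ENNReal.one_ne_top⟩⟩

/-- ★★ **(H_K) AT `N = 2` WITHOUT HYPOTHESIS, EVERY BLOCK SIZE `L`**: every guard-admitting one-variable fibre law of the typed (0.4) averaging with the printed `SU(2)`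
average is `≤ K(L)•Haar` — part 24's `fibre_law_le_of_core` fed with `core_law_le_su2_allL`.  This is the level-uniform (H_K) letter the hTop socket's weight binder
consumes (✓`UV3BranchExpansionSocketWeightsSU.hw_of_fibre_law`), for every odd `L ≥ 3`. [cite: Balaban1987RG1, (0.4) p.253 (bookkeeping — the bound is NOT in print)] -/
theorem fibre_law_le_su2_allL (hj : j + 1 ≤ P.m + P.K) :
    ∀ (c : PBond P (j + 1)) (U : GaugeField P j (Matrix.specialUnitaryGroup (Fin 2) ℂ)), (∃ g : (Matrix.specialUnitaryGroup (Fin 2) ℂ), Small (expMeanLogSU : LoopAverage (Matrix.specialUnitaryGroup (Fin 2) ℂ)) (update U (centralBond c) g) c) →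
      (HaarData.haar : Measure (Matrix.specialUnitaryGroup (Fin 2) ℂ)).map (fun g => avgFun (expMeanLogSU : LoopAverage (Matrix.specialUnitaryGroup (Fin 2) ℂ)) (update U (centralBond c) g) c) ≤
        ((ENNReal.ofReal (((((P.L : ℝ) ^ (P.d - 1)))⁻¹ * Real.sin 1 * (Real.sin (Real.pi / 3) / (Real.pi / 3))) ^ 3 * (Real.sin (Real.pi / 3) / (Real.pi / 3)) ^ 2))⁻¹ *
            ENNReal.ofReal ((2400 * Real.pi / ((((P.L : ℝ) ^ (P.d - 1)))⁻¹ * Real.sin 1) + 3) ^ 4) + 1) •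
          (HaarData.haar : Measure (Matrix.specialUnitaryGroup (Fin 2) ℂ)) :=
  fibre_law_le_of_core (expMeanLogSU : LoopAverage (Matrix.specialUnitaryGroup (Fin 2) ℂ)) hj measurable_expMeanLogSU_E fun c V _ => by
    rw [haarData_haar_eq]; exact core_law_le_su2_allL c V

/-- ★★ **PART 20's ONE-STEP EXTENSIVE TRANSPORT BOUND AT THE [B10] SLOT, `N = 2`, (H_K) DISCHARGED, EVERY BLOCK SIZE `L`**:
`h(δ′)^n • (avOfPrint)_*(dU) ≤ (h(δ′) + (K(L) − 1)·h(1∕3 + δ′)^{L^{d−1}−1})^n • dV`, `n = #PBond(j+1)` — part 24's `smul_map_avOfPrint_le_of_core` at `N = 2` fed with §2.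
HONEST: one RG step; the k-uniform `hmass` of n08-w1's target is NOT supplied (stacking); the YM mass gap is NOT proved.
[cite: Balaban1985UV3, (2) p.256; Balaban1987RG1, (0.4) p.253 (bookkeeping — the bound is NOT in print)] -/
theorem smul_map_avOfPrint_le_su2_allL {L : ℕ} (S₀ : Scales L) {j : ℕ} (hj : j + 1 ≤ S₀.P.m + S₀.P.K) (δ' : ℝ) :
    (HaarData.haar : Measure (Matrix.specialUnitaryGroup (Fin 2) ℂ)) {g : (Matrix.specialUnitaryGroup (Fin 2) ℂ) | dist1 g < δ'} ^ Fintype.card (PBond S₀.P (j + 1)) •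
        (fieldMeasure S₀.P j (Matrix.specialUnitaryGroup (Fin 2) ℂ)).map (avOfPrint 2 S₀ j).avg ≤
      ((HaarData.haar : Measure (Matrix.specialUnitaryGroup (Fin 2) ℂ)) {g : (Matrix.specialUnitaryGroup (Fin 2) ℂ) | dist1 g < δ'} +
          (((ENNReal.ofReal (((((S₀.P.L : ℝ) ^ (S₀.P.d - 1)))⁻¹ * Real.sin 1 * (Real.sin (Real.pi / 3) / (Real.pi / 3))) ^ 3 *
                (Real.sin (Real.pi / 3) / (Real.pi / 3)) ^ 2))⁻¹ *
              ENNReal.ofReal ((2400 * Real.pi / ((((S₀.P.L : ℝ) ^ (S₀.P.d - 1)))⁻¹ * Real.sin 1) + 3) ^ 4) + 1) - 1) *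
            (HaarData.haar : Measure (Matrix.specialUnitaryGroup (Fin 2) ℂ)) {g : (Matrix.specialUnitaryGroup (Fin 2) ℂ) | dist1 g < min (1 / 3) (Real.pi / (2 : ℕ)) + δ'} ^ (S₀.P.L ^ (S₀.P.d - 1) - 1)) ^
          Fintype.card (PBond S₀.P (j + 1)) •
        fieldMeasure S₀.P (j + 1) (Matrix.specialUnitaryGroup (Fin 2) ℂ) :=
  smul_map_avOfPrint_le_of_core 2 S₀ hj one_le_kallL_and_ne_top.1 one_le_kallL_and_ne_top.2 (fun c V _ => by
    rw [haarData_haar_eq]; exact core_law_le_su2_allL c V) δ'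

end Summit.QuantumFields.YangMills.BalabanUVNodes.N08HaarCompatibilityGuardCoreLawSU2AllL

end
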